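import Literature.NumberTheory.EllipticCurves.KatoChiPartVersusChiQuotient
import Mathlib.FieldTheory.IsAlgClosed.Basic
import Mathlib.RingTheory.Finiteness.Finsupp
import Mathlib.Algebra.MonoidAlgebra.MapDomain
import Mathlib.GroupTheory.FiniteAbelian.Basic
import HarnessLib

/-!
# Integral isotypic decomposition of `ℤ[G]`-modules into Kato's `χ`-parts

For a finite abelian group `G` acting `ℤ`-linearly on an abelian group `M`, K. Kato's `χ`-parts
`M^(χ) = {x ; I_χ x = 0}` (Astérisque 295 (2004), p. 235; the tree's `chiPart`,
`KatoTwistedFiniteness.lean`) for the characters `χ : G → K` into an algebraically closed field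
of characteristic zero decompose `M` **up to a non-zero integer**: this file PROVES

* `exists_sum_eq_natCast_forall_mul_eq_zero` — the group-ring statement: there are `D ≥ 1` and
  finitely many pairs `(u_i, χ_i)`, `u_i ∈ ℤ[G]`, `χ_i` a character, with `∑ u_i = D` in `ℤ[G]`
  and `u_i · I_{χ_i} = 0` (so `u_i` maps every `ℤ[G]`-module into its `χ_i`-part);
* `exists_nsmul_eq_sum_mem_chiPart` — hence `D · x = ∑ u_i x` with `u_i x ∈ M^(χ_i)` for every
  `ℤ`-linear representation `ρ` of `G` on `M` (Mathlib `Representation ℤ G M`) and every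
  `x ∈ M`;
* `isOfFinAddOrder_of_forall_mem_chiPart` — if every `ℤ[G]`-multiple of `x` lying in some
  `χ`-part has finite order, then `x` has finite order (the form used in "isotypic descent"
  arguments, where different characters are disposed of by different means);
* `addMonoid_isTorsion_of_forall_chiPart`, `finite_of_forall_finite_chiPart` — if all `χ`-parts
  are torsion then `M` is torsion; if they are finite and `M` is finitely generated then `M` is
  finite;
* `apply_add_apply_eq_zero_of_mem_chiPart` — on `M^(χ)`, `ρ(g) + ρ(h) = 0` whenever
  `χ(g) + χ(h) = 0` (e.g. an element `σ` with `χ(σ) = -1` acts as `-1` on `M^(χ)`).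

Proof of the group-ring statement (no character theory is used): by
`KatoChiPartVersusChiQuotient.lean` every character `χ` has an integral quasi-idempotent
`v_χ ∈ ℤ[G]` with `χ(v_χ) = #G` and `v_χ I_χ = 0` (`exists_quasiIdempotent`). In the commutative
ring `ℚ[G]`, the ideal `J` generated by all `v_χ` is the unit ideal: a maximal ideal `𝔪 ⊇ J` has
residue field a finite extension of `ℚ`, which embeds into `K` (Mathlib `IsAlgClosed.lift`),
giving a character `ψ` with `ψ(𝔪) = 0`, contradicting `ψ(v_ψ) = #G ≠ 0`. Writing
`1 = ∑ c_i v_{χ_i}` in `ℚ[G]` and clearing denominators gives `D = ∑ b_i v_{χ_i}` in `ℤ[G]`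
with `u_i = b_i v_{χ_i}` killing `I_{χ_i}`. (Rationally `u_i` assembles to `D · e_{[χ]}` on each
`ℚ`-conjugacy class; with character orthogonality one could take `D = #G`, which is not needed
here.)

## What is NOT here

* The optimal integer `D = #G` and the direct-sum decomposition of `M ⊗ ℚ`.
* Non-abelian `G`.

## References

* K. Kato, *`p`-adic Hodge theory and values of zeta functions of modular forms*, Astérisque 295
  (2004), 117–290, §14, Thm. 14.2 / Cor. 14.3 and the remarks around them (pp. 235–236), where
  the `χ`-parts are introduced and compared with `χ`-quotients. [Kato2004Asterisque]
-/

noncomputable section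

open Polynomial

namespace Literature.NumberTheory.EllipticCurves

section Isotypic

variable {G : Type*} [CommGroup G] {K : Type*} [Field K]

/-- The character `χ : ℚ[G] → K` (Mathlib `MonoidAlgebra.lift ℚ`) restricted along
`ℤ[G] → ℚ[G]` (`MonoidAlgebra.mapRingHom` of `ℤ → ℚ`) is `χ : ℤ[G] → K`
(`MonoidAlgebra.lift ℤ`). [folklore] -/
theorem lift_rat_mapRingHom_eq_lift_int [CharZero K] (χ : G →* K) (b : MonoidAlgebra ℤ G) :
    MonoidAlgebra.lift ℚ K G χ (MonoidAlgebra.mapRingHom G (Int.castRingHom ℚ) b) =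
      MonoidAlgebra.lift ℤ K G χ b := by
  induction b using MonoidAlgebra.induction_on with
  | hM g =>
    rw [MonoidAlgebra.lift_of, MonoidAlgebra.of_apply, MonoidAlgebra.mapRingHom_single, map_one,
      ← MonoidAlgebra.of_apply, MonoidAlgebra.lift_of]
  | hadd x y hx hy => rw [map_add, map_add, map_add, hx, hy]
  | hsmul r x hx => rw [map_zsmul, map_zsmul, map_zsmul, hx]

/-- Clearing denominators: every element of `ℚ[G]` has a positive integer multiple coming from
`ℤ[G]`. [folklore] -/
theorem exists_nsmul_eq_mapRingHom (r : MonoidAlgebra ℚ G) :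
    ∃ d : ℕ, 0 < d ∧ ∃ b : MonoidAlgebra ℤ G,
      d • r = MonoidAlgebra.mapRingHom G (Int.castRingHom ℚ) b := by
  induction r using MonoidAlgebra.induction_on with
  | hM g =>
    refine ⟨1, one_pos, MonoidAlgebra.of ℤ G g, ?_⟩
    rw [one_smul, MonoidAlgebra.of_apply, MonoidAlgebra.of_apply, MonoidAlgebra.mapRingHom_single,
      map_one]
  | hadd x y hx hy =>
    obtain ⟨d₁, hd₁, b₁, hb₁⟩ := hx
    obtain ⟨d₂, hd₂, b₂, hb₂⟩ := hy
    refine ⟨d₁ * d₂, Nat.mul_pos hd₁ hd₂, d₂ • b₁ + d₁ • b₂, ?_⟩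
    rw [smul_add, mul_comm d₁ d₂, mul_nsmul', hb₁, mul_comm d₂ d₁, mul_nsmul', hb₂, map_add,
      map_nsmul, map_nsmul]
  | hsmul q x hx =>
    obtain ⟨d, hd, b, hb⟩ := hx
    refine ⟨q.den * d, Nat.mul_pos q.den_pos hd, q.num • b, ?_⟩
    have h1 : q.den • q • x = q.num • x := by
      rw [← Nat.cast_smul_eq_nsmul ℚ, smul_smul, Rat.den_mul_eq_num, Int.cast_smul_eq_zsmul]
    rw [map_zsmul, ← hb, mul_comm, mul_nsmul', h1, smul_comm]

variable [Fintype G] [CharZero K] [IsAlgClosed K]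

variable (G K) in
/-- **Integral isotypic decomposition in the group ring.** For a finite abelian group `G` and an
algebraically closed field `K` of characteristic zero there are `D ≥ 1` and finitely many pairs
`(u_i, χ_i)` of elements `u_i ∈ ℤ[G]` and characters `χ_i : G → K` with `∑ u_i = D` in `ℤ[G]`
and `u_i · a = 0` for every `a ∈ I_{χ_i} = ker(χ_i : ℤ[G] → K)`. Proof: the ideal of `ℚ[G]`
generated by the integral quasi-idempotents `v_χ` (`exists_quasiIdempotent`: `χ(v_χ) = #G`,
`v_χ I_χ = 0`) lies in no maximal ideal `𝔪` — the residue field of `𝔪` is finite over `ℚ` and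
embeds in `K` (`IsAlgClosed.lift`), producing a character `ψ` vanishing on `𝔪 ∋ v_ψ` although
`ψ(v_ψ) = #G ≠ 0` — so `1 = ∑ c_i v_{χ_i}`; clear denominators (`exists_nsmul_eq_mapRingHom`)
and pull back along the injection `ℤ[G] → ℚ[G]`. [folklore] -/
theorem exists_sum_eq_natCast_forall_mul_eq_zero :
    ∃ D : ℕ, 0 < D ∧ ∃ l : List (MonoidAlgebra ℤ G × (G →* K)),
      (l.map Prod.fst).sum = (D : MonoidAlgebra ℤ G) ∧
      ∀ p ∈ l, ∀ a : MonoidAlgebra ℤ G, MonoidAlgebra.lift ℤ K G p.2 a = 0 → p.1 * a = 0 := by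
  classical
  choose v hv1 hv2 using fun χ : G →* K => exists_quasiIdempotent χ
  set ι : MonoidAlgebra ℤ G →+* MonoidAlgebra ℚ G :=
    MonoidAlgebra.mapRingHom G (Int.castRingHom ℚ) with hι
  have hιinj : Function.Injective ι := MonoidAlgebra.map_injective _ Int.cast_injective
  set J : Ideal (MonoidAlgebra ℚ G) := Ideal.span (Set.range fun χ : G →* K => ι (v χ)) with hJ
  -- `J` is the unit ideal: a maximal ideal containing it is the kernel of a character `ψ`,
  -- but `ψ(v_ψ) = #G ≠ 0`
  have hJtop : J = ⊤ := by
    by_contra hne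
    obtain ⟨P, hP, hJP⟩ := Ideal.exists_le_maximal J hne
    letI : Field (MonoidAlgebra ℚ G ⧸ P) := Ideal.Quotient.field P
    haveI : Module.Finite ℚ (MonoidAlgebra ℚ G ⧸ P) :=
      Module.Finite.of_surjective (Ideal.Quotient.mkₐ ℚ P).toLinearMap
        (Ideal.Quotient.mkₐ_surjective ℚ P)
    haveI : Algebra.IsAlgebraic ℚ (MonoidAlgebra ℚ G ⧸ P) := Algebra.IsAlgebraic.of_finite ℚ _
    let φ : (MonoidAlgebra ℚ G ⧸ P) →ₐ[ℚ] K := IsAlgClosed.lift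
    let ψ : G →* K :=
      ((φ.comp (Ideal.Quotient.mkₐ ℚ P)) : MonoidAlgebra ℚ G →* K).comp (MonoidAlgebra.of ℚ G)
    have hψ : ∀ r : MonoidAlgebra ℚ G,
        MonoidAlgebra.lift ℚ K G ψ r = φ (Ideal.Quotient.mkₐ ℚ P r) := fun r => by
      induction r using MonoidAlgebra.induction_on with
      | hM g => rw [MonoidAlgebra.lift_of]; rfl
      | hadd x y hx hy => rw [map_add, map_add, map_add, hx, hy]
      | hsmul q x hx => rw [map_smul, map_smul, map_smul, hx]
    have hmem : ι (v ψ) ∈ P := hJP (Ideal.subset_span ⟨ψ, rfl⟩)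
    have h0 : MonoidAlgebra.lift ℚ K G ψ (ι (v ψ)) = 0 := by
      rw [hψ, Ideal.Quotient.mkₐ_eq_mk, Ideal.Quotient.eq_zero_iff_mem.mpr hmem, map_zero]
    rw [hι, lift_rat_mapRingHom_eq_lift_int, hv1] at h0
    exact (Nat.cast_ne_zero.mpr Fintype.card_ne_zero) h0
  -- write `1` as a combination of the `v_χ` and clear denominators
  have h1 : (1 : MonoidAlgebra ℚ G) ∈ J := hJtop ▸ Submodule.mem_top
  obtain ⟨c, t, ht, -, hsum⟩ := Submodule.mem_span_iff_exists_finset_subset.mp h1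
  have hχ : ∀ a ∈ t, ∃ χ : G →* K, ι (v χ) = a := fun a ha => ht ha
  choose! χof hχof using hχ
  choose d hd b hb using fun a : MonoidAlgebra ℚ G => exists_nsmul_eq_mapRingHom (c a)
  set D : ℕ := ∏ a ∈ t, d a with hD
  have hDpos : 0 < D := Finset.prod_pos fun a _ => hd a
  refine ⟨D, hDpos, t.toList.map fun a => ((D / d a) • b a * v (χof a), χof a), ?_, ?_⟩
  · -- apply the injection `ι`
    apply hιinj
    rw [List.map_map, map_list_sum, List.map_map, map_natCast]
    have : ((⇑ι ∘ Prod.fst ∘ fun a => ((D / d a) • b a * v (χof a), χof a)) : _ → _) =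
        fun a => ι ((D / d a) • b a * v (χof a)) := rfl
    rw [this, Finset.sum_map_toList]
    have hterm : ∀ a ∈ t, ι ((D / d a) • b a * v (χof a)) = D • (c a • a) := fun a ha => by
      rw [map_mul, map_nsmul, hχof a ha, ← hb a, smul_smul,
        Nat.div_mul_cancel (Finset.dvd_prod_of_mem d ha), smul_mul_assoc, smul_eq_mul]
    rw [Finset.sum_congr rfl hterm, ← Finset.smul_sum, hsum, nsmul_eq_mul, mul_one]
  · intro p hp a ha
    obtain ⟨a', ha', rfl⟩ := List.mem_map.mp hp
    dsimp only at ha ⊢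
    rw [mul_assoc, hv2 _ a ha, mul_zero]

end Isotypic

section IsotypicModule

variable {G : Type*} [CommGroup G] [Fintype G] {K : Type*} [Field K] [CharZero K] [IsAlgClosed K]
variable {M : Type*} [AddCommGroup M]

omit [Fintype G] [CharZero K] [IsAlgClosed K] in
/-- A sum of endomorphisms applied to `x` is the sum of the values. [folklore] -/
theorem list_sum_moduleEnd_apply (L : List (Module.End ℤ M)) (x : M) :
    L.sum x = (L.map fun f => f x).sum := by
  induction L with
  | nil => rfl
  | cons f L ih => rw [List.sum_cons, List.map_cons, List.sum_cons, LinearMap.add_apply, ih]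

omit [Fintype G] [CharZero K] [IsAlgClosed K] in
/-- A finite sum of elements of finite order in an abelian group has finite order. [folklore] -/
theorem isOfFinAddOrder_list_sum (L : List M) (h : ∀ y ∈ L, IsOfFinAddOrder y) :
    IsOfFinAddOrder L.sum := by
  induction L with
  | nil => exact IsOfFinAddOrder.zero
  | cons y L ih =>
    rw [List.sum_cons]
    exact (h y (List.mem_cons_self)).add
      (ih fun z hz => h z (List.mem_cons_of_mem y hz))

/-- **Isotypic decomposition of a `ℤ[G]`-module up to a non-zero integer.** For a `ℤ`-linear
representation `ρ` of a finite abelian group `G` on `M` there are `D ≥ 1` and finitely many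
`(u_i, χ_i)` such that `D · x = ∑ u_i x` for all `x ∈ M`, with `u_i x` in Kato's `χ_i`-part
`M^(χ_i)` (`chiPart`; characters with values in an algebraically closed field of characteristic
zero, e.g. `ℂ`). From `exists_sum_eq_natCast_forall_mul_eq_zero`: `u_i I_{χ_i} = 0` forces
`u_i x ∈ M^(χ_i)` (`mem_chiPart_iff_asAlgebraHom`). [folklore] -/
theorem exists_nsmul_eq_sum_mem_chiPart (ρ : Representation ℤ G M) :
    ∃ D : ℕ, 0 < D ∧ ∃ l : List (MonoidAlgebra ℤ G × (G →* K)),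
      (∀ x : M, D • x = (l.map fun p => ρ.asAlgebraHom p.1 x).sum) ∧
      ∀ p ∈ l, ∀ x : M, ρ.asAlgebraHom p.1 x ∈ chiPart (fun g => (ρ g).toAddMonoidHom) p.2 := by
  obtain ⟨D, hD, l, hsum, hann⟩ := exists_sum_eq_natCast_forall_mul_eq_zero G K
  refine ⟨D, hD, l, fun x => ?_, fun p hp x => ?_⟩
  · have h := congrArg (fun u : MonoidAlgebra ℤ G => ρ.asAlgebraHom u x) hsum
    simp only [map_list_sum, List.map_map, map_natCast, Module.End.natCast_apply] at h
    rw [← h, list_sum_moduleEnd_apply, List.map_map]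
    rfl
  · rw [mem_chiPart_iff_asAlgebraHom]
    intro a ha
    rw [← Module.End.mul_apply, ← map_mul, mul_comm, hann p hp a ha, map_zero,
      LinearMap.zero_apply]

/-- **Isotypic descent of finite order.** If every `ℤ[G]`-multiple `u x` of `x` that lies in some
`χ`-part `M^(χ)` has finite order, then `x` has finite order: `D x = ∑ u_i x` with
`u_i x ∈ M^(χ_i)` (`exists_nsmul_eq_sum_mem_chiPart`). This is the shape used when different
characters are handled by different arguments (e.g. finiteness of `M^(χ)` for some `χ`, and a
sign argument `apply_add_apply_eq_zero_of_mem_chiPart` for the others). [folklore] -/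
theorem isOfFinAddOrder_of_forall_mem_chiPart (ρ : Representation ℤ G M) (x : M)
    (h : ∀ (χ : G →* K) (w : MonoidAlgebra ℤ G),
      ρ.asAlgebraHom w x ∈ chiPart (fun g => (ρ g).toAddMonoidHom) χ →
        IsOfFinAddOrder (ρ.asAlgebraHom w x)) :
    IsOfFinAddOrder x := by
  obtain ⟨D, hD, l, hsum, hmem⟩ := exists_nsmul_eq_sum_mem_chiPart (K := K) ρ
  have hDx : IsOfFinAddOrder (D • x) := by
    rw [hsum x]
    refine isOfFinAddOrder_list_sum _ fun y hy => ?_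
    obtain ⟨p, hp, rfl⟩ := List.mem_map.mp hy
    exact h p.2 p.1 (hmem p hp x)
  obtain ⟨n, hn, hnx⟩ := (isOfFinAddOrder_iff_nsmul_eq_zero).mp hDx
  exact (isOfFinAddOrder_iff_nsmul_eq_zero).mpr ⟨n * D, Nat.mul_pos hn hD, by rw [mul_nsmul', hnx]⟩

/-- If every `χ`-part of a `ℤ`-linear representation of a finite abelian group is torsion, the
whole module is torsion. [folklore] -/
theorem addMonoid_isTorsion_of_forall_chiPart (ρ : Representation ℤ G M)
    (h : ∀ χ : G →* K, ∀ y ∈ chiPart (fun g => (ρ g).toAddMonoidHom) χ, IsOfFinAddOrder y) :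
    AddMonoid.IsTorsion M := fun x =>
  isOfFinAddOrder_of_forall_mem_chiPart (K := K) ρ x fun χ _ hu => h χ _ hu

/-- If every `χ`-part of a `ℤ`-linear representation of a finite abelian group on a finitely
generated abelian group `M` is finite, then `M` is finite (torsion and finitely generated,
Mathlib `AddCommGroup.finite_of_fg_torsion`). [folklore] -/
theorem finite_of_forall_finite_chiPart [Module.Finite ℤ M] (ρ : Representation ℤ G M)
    (h : ∀ χ : G →* K, Finite (chiPart (fun g => (ρ g).toAddMonoidHom) χ)) : Finite M := by
  haveI : AddGroup.FG M := Module.Finite.iff_addGroup_fg.mp inferInstance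
  refine AddCommGroup.finite_of_fg_torsion M (addMonoid_isTorsion_of_forall_chiPart (K := K) ρ ?_)
  intro χ y hy
  haveI := h χ
  have hy' := isOfFinAddOrder_of_finite (⟨y, hy⟩ : chiPart (fun g => (ρ g).toAddMonoidHom) χ)
  exact (chiPart (fun g => (ρ g).toAddMonoidHom) χ).subtype.isOfFinAddOrder hy'

omit [CommGroup G] [Fintype G] in
/-- **Signs on a `χ`-part.** For `x ∈ M^(χ)` and `g, h ∈ G` with `χ(g) + χ(h) = 0` one has
`ρ(g) x + ρ(h) x = 0`, since `g + h ∈ I_χ`; e.g. an element `σ` with `χ(σ) = -1 = -χ(1)` acts as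
`-1` on `M^(χ)` ("odd" parts under a complex conjugation). Stated for arbitrary operators
`ρ : G → (M →+ M)` and functions `χ : G → R`, as `chiPart` is. [folklore] -/
theorem apply_add_apply_eq_zero_of_mem_chiPart {R : Type*} [CommRing R] {ρ : G → M →+ M}
    {χ : G → R} {x : M} (hx : x ∈ chiPart ρ χ) {g h : G} (hgh : χ g + χ h = 0) :
    ρ g x + ρ h x = 0 := by
  classical
  have key := hx (Finsupp.single g 1 + Finsupp.single h 1) (by
    rw [Finsupp.sum_add_index' (h := fun g (n : ℤ) => (n : R) * χ g) (fun _ => by simp)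
      (fun _ _ _ => by push_cast; ring),
      Finsupp.sum_single_index (by simp), Finsupp.sum_single_index (by simp)]
    simpa using hgh)
  rw [Finsupp.sum_add_index' (h := fun g (n : ℤ) => n • ρ g x) (fun _ => zero_smul _ _)
    (fun _ _ _ => add_smul _ _ _)] at key
  simpa only [Finsupp.sum_single_index, zero_smul, one_smul] using key

end IsotypicModule

end Literature.NumberTheory.EllipticCurves

end
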